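import Summits.MatrixMultiplication.OmegaCensus.STPPAlignedInvolutionClash

/-!
# ω-census (abelian STPP census): filter N19U — the involution clash for groups with a UNIQUE involution (cyclic groups of even order; kernel)

HONEST FRAMING (pub-omega census; verbatim): lottery ticket; floor = certified bounds/negative ranges.
Census BOOKKEEPING / STRUCTURE (seat pub-omega-stpp-1 gen 27, 2026-08-27), family (b2).  Supplement to `STPPAlignedInvolutionClash.lean` (N19): there the
uniqueness of the involution came from `4 ∤ |H|`; the clash itself only needs «`H` has at most one element of order 2», which also holds in every CYCLIC group
of even order (`ZMod n`: `x + x = 0 ↔ x ∈ {0, n/2}`) — e.g. ℤ₆₀ and ℤ₆₄, the cyclic census groups of the next orders where `4 ∣ n` makes N19 void (ℤ₂×ℤ₃₀, with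
three involutions, is NOT covered).  Nothing here is progress on `ω`.

* `involution_clash_of_unique` — N19's theorem with the hypothesis `huniq : ∀ x y, x ≠ 0 → y ≠ 0 → x + x = 0 → y + y = 0 → x = y` in place of `4 ∤ |H|`
  (same proof, verbatim);
* `N19UDead` — the card-vector predicate WITHOUT the `¬ 4 ∣ n` conjunct, `not_isSTPP_of_n19UDead{1,,'}` (six role readings) under `huniq`;
* `ZMod.involution_unique` — `huniq` for `ZMod n` (any `n ≥ 1`), and the front end `not_isSTPP_zmod_of_n19UDead'`;
* example: the ℤ₅₈ leaf `{(2,4,4),(2,4,4)}` again, through the `ZMod` front end (`no_isSTPP_zmod58_244_244`); the intended customers are the ℤ₆₀ / ℤ₆₄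
  fronts once listed (the predicate is evaluated per pattern by `decide`, exactly like `N19Dead`).

References: M. Kneser, Math. Z. 58 (1953); H. Cohn, R. Kleinberg, B. Szegedy, C. Umans, FOCS 2005 (arXiv:math/0511460), Def. 5.1.
-/

open Finset
open scoped Pointwise

namespace Summit.MatrixMultiplication.OmegaCensus.CubeNB

open Literature.Computability.AlgebraicComplexity
open Summit.MatrixMultiplication.OmegaCensus.STPPKneser

variable {H : Type*} [AddCommGroup H] [DecidableEq H] [Fintype H] {N : ℕ} {A B C : Fin N → Finset H}

/-! ## §1 The clash under a uniqueness hypothesis -/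

section Law

/-- **N19U (involution clash, uniqueness form).**  As `involution_clash`, with «at most one involution» as a hypothesis instead of `4 ∤ |H|`.
[cite: Kneser1953] [cite: CohnKleinbergSzegedyUmans2005, Def. 5.1] -/
theorem involution_clash_of_unique (hS : IsSTPP A B C) (hA : ∀ i, (A i).Nonempty) (hB : ∀ i, (B i).Nonempty)
    (hC : ∀ i, (C i).Nonempty)
    (huniq : ∀ x y : H, x ≠ 0 → y ≠ 0 → x + x = 0 → y + y = 0 → x = y) (i : Fin N) (hI : (univ.erase i : Finset (Fin N)).Nonempty)
    (h1 : ∀ d d' : ℕ, 0 < d → d ∣ Fintype.card H → 0 < d' → d' ∣ Fintype.card H →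
      ∑ k ∈ univ.erase i, #(A k) * #(C k) +
        kneserLB #(B i) (#(A i) * #(B i) * #(C i) + kneserLB #(A i) (∑ k ∈ univ.erase i, #(B k) * #(C k)) d') d ≤
          Fintype.card H → d = 2 ∧ d' = 2)
    (h2 : ∀ t : ℕ, t ≤ Fintype.card H → kneserLB #(B i) t 2 + ∑ k ∈ univ.erase i, #(A k) * #(C k) ≤ Fintype.card H →
      t + 2 < 2 * #(A i) + #(A i) * #(B i) * #(C i) + ∑ k ∈ univ.erase i, #(B k) * #(C k))
    (h3 : Fintype.card H + 2 < 2 * #(B i) + ∑ k ∈ univ.erase i, #(A k) * #(C k) + #(A i) * #(B i) * #(C i) +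
      kneserLB #(A i) (∑ k ∈ univ.erase i, #(B k) * #(C k)) 2) : False := by
  -- the sets
  set W := ((A i) ×ˢ ((B i) ×ˢ (C i))).image fun q : H × H × H => (0 : H) + q.2.2 - q.1 - q.2.1 with hW
  set S := (A i).image (fun a => (0 : H) - a) with hSdef
  set Yo := DU B C (univ.erase i) with hYo
  set Zo := DU A C (univ.erase i) with hZo
  set V := W ∪ (S + Yo) with hV
  have hWcard : #W = #(A i) * #(B i) * #(C i) := card_image_blockSum hS i 0
  have hScard : #S = #(A i) := Finset.card_image_of_injective _ (sub_right_injective)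
  have hYcard : #Yo = ∑ k ∈ univ.erase i, #(B k) * #(C k) := card_DU_BC hS hA _
  have hZcard : #Zo = ∑ k ∈ univ.erase i, #(A k) * #(C k) := card_DU_AC hS hB _
  have hSne : S.Nonempty := (hA i).image _
  have hYne : Yo.Nonempty := DU_nonempty hI hB hC
  have hSYne : (S + Yo).Nonempty := hSne.add hYne
  have hWV : Disjoint W (S + Yo) := disjoint_W_negA_add_DU hS i
  have hVcard : #V = #W + #(S + Yo) := Finset.card_union_of_disjoint hWV
  have hVne : V.Nonempty := hSYne.mono Finset.subset_union_right
  have hBVne : (B i + V).Nonempty := (hB i).add hVne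
  -- the inclusion Bᵢ + V ⊆ H ∖ Z°
  have hU : #(univ \ Zo) = Fintype.card H - #Zo := by
    rw [Finset.card_sdiff_of_subset (Finset.subset_univ _), Finset.card_univ]
  have hZle : #Zo ≤ Fintype.card H := Finset.card_le_univ _
  have hsub0 := Finset.card_le_card (B_add_W_union_negA_add_subset hS i)
  rw [hU] at hsub0
  have hsub : #(B i + V) ≤ Fintype.card H - #Zo := hsub0
  -- the two stabilizers
  set K := (B i + V).addStab with hK
  set K' := (S + Yo).addStab with hK'
  have hKne : K.Nonempty := hBVne.addStab
  have hK'ne : K'.Nonempty := hSYne.addStab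
  have hKdvd : #K ∣ Fintype.card H := hBVne.card_addStab_dvd_card_univ
  have hK'dvd : #K' ∣ Fintype.card H := hSYne.card_addStab_dvd_card_univ
  -- Kneser with the true stabilizers
  have hkK' : kneserLB #S #Yo #K' ≤ #(S + Yo) := kneserLB_card_addStab_le S Yo hSne hYne
  have hkK : kneserLB #(B i) #V #K ≤ #(B i + V) := kneserLB_card_addStab_le (B i) V (hB i) hVne
  have hVge : #(A i) * #(B i) * #(C i) + kneserLB #(A i) (∑ k ∈ univ.erase i, #(B k) * #(C k)) #K' ≤ #V := by
    rw [hVcard, hWcard, ← hScard, ← hYcard]; omega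
  have hmono := kneserLB_mono_right #(B i) #K hVge
  -- (|K|, |K'|) is a rescuing pair, hence (2, 2)
  obtain ⟨hK2, hK'2⟩ := h1 #K #K' hKne.card_pos hKdvd hK'ne.card_pos hK'dvd (by rw [← hZcard]; omega)
  -- structural Kneser inequalities
  have hknS := Literature.Combinatorics.Additive.add_kneser S Yo
  have hknB := Literature.Combinatorics.Additive.add_kneser (B i) V
  rw [← hK'] at hknS
  rw [← hK] at hknB
  have hYoK' : #Yo ≤ #(Yo + K') := card_le_card_add_right hK'ne
  have hVK : #V ≤ #(V + K) := card_le_card_add_right hKne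
  -- A-side: |S + K'| < 2 |S|
  have hkK2 : kneserLB #(B i) #V 2 ≤ #(B i + V) := by rw [← hK2]; exact hkK
  have h2' := h2 #V (Finset.card_le_univ _) (by rw [← hZcard]; omega)
  have hSlt : #(S + K') < 2 * #S := by
    rw [hK'2] at hknS
    rw [hScard]; rw [hVcard, hWcard, ← hYcard] at h2'
    omega
  -- B-side: |Bᵢ + K| < 2 |Bᵢ|
  have hkK'2 : kneserLB #(A i) (∑ k ∈ univ.erase i, #(B k) * #(C k)) 2 ≤ #(S + Yo) := by
    rw [← hK'2, ← hScard, ← hYcard]; exact hkK'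
  have hBlt : #(B i + K) < 2 * #(B i) := by
    rw [hK2] at hknB
    rw [hVcard, hWcard] at hVK
    rw [← hZcard] at h3
    omega
  -- the involutions of K and K' coincide
  obtain ⟨κ, hκ0, h2κ, hκK⟩ := exists_involution_of_card_addStab_eq_two hBVne (hK ▸ hK2)
  obtain ⟨κ', hκ'0, h2κ', hκ'K⟩ := exists_involution_of_card_addStab_eq_two hSYne (hK' ▸ hK'2)
  have hι : κ = κ' := huniq κ κ' hκ0 hκ'0 h2κ h2κ'
  rw [← hK] at hκK
  rw [← hK', ← hι] at hκ'K
  -- two points of Aᵢ and two points of Bᵢ differing by κ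
  obtain ⟨x, hx, hxk⟩ := exists_add_mem_of_card_add_lt (Finset.zero_mem_addStab.2 hSYne |> (hK' ▸ ·)) hκ'K hSlt
  obtain ⟨b₁, hb₁, hb₂⟩ := exists_add_mem_of_card_add_lt (Finset.zero_mem_addStab.2 hBVne |> (hK ▸ ·)) hκK hBlt
  obtain ⟨a₁, ha₁, rfl⟩ := Finset.mem_image.1 hx
  obtain ⟨a₂, ha₂, ha₂e⟩ := Finset.mem_image.1 hxk
  obtain ⟨c₀, hc₀⟩ := hC i
  -- (a₁ − a₂) + (b₁ − (b₁ + κ)) + (c₀ − c₀) = 0: the TPP of block i forces a₂ = a₁, i.e. κ = 0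
  have hk : a₁ - a₂ = κ := by
    have h' : -a₂ = -a₁ + κ := by simpa only [zero_sub] using ha₂e
    rw [sub_eq_add_neg, h']; abel
  have hrel : (a₁ - a₂) + (b₁ - (b₁ + κ)) + (c₀ - c₀) = 0 := by
    rw [hk]; abel
  obtain ⟨-, -, h12, -, -⟩ := hS i i i a₂ ha₂ a₁ ha₁ (b₁ + κ) hb₂ b₁ hb₁ c₀ hc₀ c₀ hc₀ hrel
  apply hκ0
  rw [← hk, h12, sub_self]

end Law

/-! ## §2 The decidable card-vector predicate (six readings) and the filter theorem -/

section Filter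

/-- **Filter N19U, one reading** on the card vectors (`C`-reading; NO order hypothesis — the uniqueness of the involution is a separate hypothesis of the theorem): some block `i` (another block present) satisfies (1) every rescuing pair is
`(2,2)`, (2) the A-side count, (3) the B-side count.  Same verdicts as `N19Dead1` without the conjunct `¬ 4 ∣ n` (HOME `pub-omega-stpp-1-g27/code/n19_filter.py` with the order test removed). [folklore] -/
def N19UDead1 (n N : ℕ) (a b c : Fin N → ℕ) : Bool :=
  decide (∃ i j : Fin N, j ≠ i ∧
    (∀ d ∈ Nat.divisors n, ∀ d' ∈ Nat.divisors n,
      n < ∑ k ∈ univ.erase i, a k * c k + kneserLB (b i) (a i * b i * c i + kneserLB (a i) (∑ k ∈ univ.erase i, b k * c k) d') d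
        ∨ (d = 2 ∧ d' = 2)) ∧
    (∀ t : ℕ, t < n + 1 → kneserLB (b i) t 2 + ∑ k ∈ univ.erase i, a k * c k ≤ n →
      t + 2 < 2 * a i + a i * b i * c i + ∑ k ∈ univ.erase i, b k * c k) ∧
    (n + 2 < 2 * b i + ∑ k ∈ univ.erase i, a k * c k + a i * b i * c i + kneserLB (a i) (∑ k ∈ univ.erase i, b k * c k) 2))

/-- **Filter N19U** on the card vectors: `N19UDead1` for one of the six role permutations. [folklore] -/
def N19UDead (n N : ℕ) (a b c : Fin N → ℕ) : Bool :=
  N19UDead1 n N a b c || N19UDead1 n N b c a || N19UDead1 n N c a b ||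
    N19UDead1 n N c b a || N19UDead1 n N b a c || N19UDead1 n N a c b

/-- **Filter N19U, one reading (kernel)**, for a group with at most one involution. [cite: Kneser1953] [cite: CohnKleinbergSzegedyUmans2005, Def. 5.1] -/
theorem not_isSTPP_of_n19UDead1 (hS : IsSTPP A B C) (hA : ∀ i, (A i).Nonempty) (hB : ∀ i, (B i).Nonempty)
    (hC : ∀ i, (C i).Nonempty) (huniq : ∀ x y : H, x ≠ 0 → y ≠ 0 → x + x = 0 → y + y = 0 → x = y)
    {n : ℕ} (hn : Fintype.card H = n) {a b c : Fin N → ℕ} (ha : ∀ i, #(A i) = a i)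
    (hb : ∀ i, #(B i) = b i) (hc : ∀ i, #(C i) = c i) (hdead : N19UDead1 n N a b c = true) : False := by
  obtain ⟨i, j, hji, h1, h2, h3⟩ := of_decide_eq_true hdead
  have hI : (univ.erase i : Finset (Fin N)).Nonempty := ⟨j, Finset.mem_erase.2 ⟨hji, Finset.mem_univ _⟩⟩
  have hn0 : n ≠ 0 := by rw [← hn]; exact Fintype.card_ne_zero
  have eAC : ∑ k ∈ univ.erase i, #(A k) * #(C k) = ∑ k ∈ univ.erase i, a k * c k :=
    Finset.sum_congr rfl fun k _ => by rw [ha, hc]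
  have eBC : ∑ k ∈ univ.erase i, #(B k) * #(C k) = ∑ k ∈ univ.erase i, b k * c k :=
    Finset.sum_congr rfl fun k _ => by rw [hb, hc]
  refine involution_clash_of_unique hS hA hB hC huniq i hI ?_ ?_ ?_
  · intro d d' hd hdvd hd' hdvd' hle
    rw [hn] at hdvd hdvd' hle
    rw [ha, hb, hc, eAC, eBC] at hle
    rcases h1 d (Nat.mem_divisors.2 ⟨hdvd, hn0⟩) d' (Nat.mem_divisors.2 ⟨hdvd', hn0⟩) with h | h
    · omega
    · exact h
  · intro t htle ht
    rw [hn] at htle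
    rw [hn, hb, eAC] at ht
    have := h2 t (by omega) ht
    rw [ha, hb, hc, eBC]
    exact this
  · rw [hn, ha, hb, hc, eAC, eBC]
    exact h3

/-- **Filter N19U (kernel): an STPP family with non-empty sets in a finite abelian group `H` WITH AT MOST ONE INVOLUTION whose pattern is `N19UDead |H|` does not exist** —
six readings via `stpp_rotate` and `isSTPP_neg_reverse`. [cite: Kneser1953] [cite: CohnKleinbergSzegedyUmans2005, Def. 5.1] -/
theorem not_isSTPP_of_n19UDead (hS : IsSTPP A B C) (hA : ∀ i, (A i).Nonempty) (hB : ∀ i, (B i).Nonempty)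
    (hC : ∀ i, (C i).Nonempty) (huniq : ∀ x y : H, x ≠ 0 → y ≠ 0 → x + x = 0 → y + y = 0 → x = y)
    {n : ℕ} (hn : Fintype.card H = n) {a b c : Fin N → ℕ} (ha : ∀ i, #(A i) = a i)
    (hb : ∀ i, #(B i) = b i) (hc : ∀ i, #(C i) = c i) (hdead : N19UDead n N a b c = true) : False := by
  simp only [N19UDead, Bool.or_eq_true] at hdead
  have hR := isSTPP_neg_reverse hS
  have hnA : ∀ i, #((fun j => -(A j)) i) = a i := fun i => by rw [card_neg_family, ha]
  have hnB : ∀ i, #((fun j => -(B j)) i) = b i := fun i => by rw [card_neg_family, hb]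
  have hnC : ∀ i, #((fun j => -(C j)) i) = c i := fun i => by rw [card_neg_family, hc]
  rcases hdead with ((((h | h) | h) | h) | h) | h
  · exact not_isSTPP_of_n19UDead1 hS hA hB hC huniq hn ha hb hc h
  · exact not_isSTPP_of_n19UDead1 (stpp_rotate hS) hB hC hA huniq hn hb hc ha h
  · exact not_isSTPP_of_n19UDead1 (stpp_rotate (stpp_rotate hS)) hC hA hB huniq hn hc ha hb h
  · exact not_isSTPP_of_n19UDead1 hR (nonempty_neg_family hC) (nonempty_neg_family hB) (nonempty_neg_family hA)
      huniq hn hnC hnB hnA h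
  · exact not_isSTPP_of_n19UDead1 (stpp_rotate hR) (nonempty_neg_family hB) (nonempty_neg_family hA)
      (nonempty_neg_family hC) huniq hn hnB hnA hnC h
  · exact not_isSTPP_of_n19UDead1 (stpp_rotate (stpp_rotate hR)) (nonempty_neg_family hA) (nonempty_neg_family hC)
      (nonempty_neg_family hB) huniq hn hnA hnC hnB h

/-- Card-vector form with literal vectors: non-emptiness from positivity of the entries. [cite: Kneser1953] [cite: CohnKleinbergSzegedyUmans2005, Def. 5.1] -/
theorem not_isSTPP_of_n19UDead' (hS : IsSTPP A B C)
    (huniq : ∀ x y : H, x ≠ 0 → y ≠ 0 → x + x = 0 → y + y = 0 → x = y) {n : ℕ} (hn : Fintype.card H = n) (a b c : Fin N → ℕ)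
    (ha : ∀ i, #(A i) = a i) (hb : ∀ i, #(B i) = b i) (hc : ∀ i, #(C i) = c i)
    (hpos : ∀ i, 0 < a i ∧ 0 < b i ∧ 0 < c i) (hdead : N19UDead n N a b c = true) : False :=
  not_isSTPP_of_n19UDead hS (fun i => card_pos.1 ((ha i).symm ▸ (hpos i).1))
    (fun i => card_pos.1 ((hb i).symm ▸ (hpos i).2.1)) (fun i => card_pos.1 ((hc i).symm ▸ (hpos i).2.2))
    huniq hn ha hb hc hdead

end Filter

/-! ## §3 Cyclic groups: `ZMod n` has at most one involution -/

section Cyclic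

/-- In `ZMod n` (`n ≥ 1`) two nonzero elements `x, y` with `x + x = 0 = y + y` are equal: both have `val = n / 2` (`2·val ≡ 0 (mod n)` with `0 < val < n`
forces `2·val = n`). [folklore] -/
theorem ZMod.involution_unique (n : ℕ) [NeZero n] :
    ∀ x y : ZMod n, x ≠ 0 → y ≠ 0 → x + x = 0 → y + y = 0 → x = y := by
  have key : ∀ x : ZMod n, x ≠ 0 → x + x = 0 → 2 * x.val = n := by
    intro x hx h2
    have hlt : x.val < n := ZMod.val_lt x
    have hpos : 0 < x.val := Nat.pos_of_ne_zero fun h => hx ((ZMod.val_eq_zero x).1 h)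
    have hdvd : n ∣ x.val + x.val := by
      have : ((x.val + x.val : ℕ) : ZMod n) = 0 := by
        rw [Nat.cast_add, ZMod.natCast_zmod_val, h2]
      exact (ZMod.natCast_eq_zero_iff _ _).1 this
    obtain ⟨q, hq⟩ := hdvd
    have hq1 : q = 1 := by
      rcases Nat.lt_or_ge q 2 with h | h
      · interval_cases q
        · omega
        · rfl
      · nlinarith
    subst hq1
    omega
  intro x y hx hy h2x h2y
  have h := key x hx h2x
  have h' := key y hy h2y
  have : x.val = y.val := by omega
  exact (ZMod.val_injective n this)

/-- **Filter N19U for cyclic groups (kernel front end).**  An STPP family in `ZMod n` whose literal card vectors are `N19UDead n` does not exist.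
[cite: Kneser1953] [cite: CohnKleinbergSzegedyUmans2005, Def. 5.1] -/
theorem not_isSTPP_zmod_of_n19UDead' {n : ℕ} [NeZero n] {A B C : Fin N → Finset (ZMod n)} (hS : IsSTPP A B C)
    (a b c : Fin N → ℕ) (ha : ∀ i, #(A i) = a i) (hb : ∀ i, #(B i) = b i) (hc : ∀ i, #(C i) = c i)
    (hpos : ∀ i, 0 < a i ∧ 0 < b i ∧ 0 < c i) (hdead : N19UDead n N a b c = true) : False :=
  not_isSTPP_of_n19UDead' hS (ZMod.involution_unique n) (ZMod.card n) a b c ha hb hc hpos hdead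

/-- Example through the cyclic front end: no STPP family with pattern `{(2,4,4),(2,4,4)}` in `ZMod 58` (cf. `no_isSTPP_card58_244_244`).
[cite: Kneser1953] [cite: CohnKleinbergSzegedyUmans2005, Def. 5.1] -/
theorem no_isSTPP_zmod58_244_244 (A B C : Fin 2 → Finset (ZMod 58)) (hS : IsSTPP A B C)
    (hA : ∀ i, #(A i) = ![2, 2] i) (hB : ∀ i, #(B i) = ![4, 4] i) (hC : ∀ i, #(C i) = ![4, 4] i) : False :=
  not_isSTPP_zmod_of_n19UDead' hS _ _ _ hA hB hC (by decide) (by decide)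

end Cyclic

end Summit.MatrixMultiplication.OmegaCensus.CubeNB
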